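import Literature.NumberTheory.Automorphic.JacquetNonzeroEmbedsNormalizedInd        -- ★ brick A `exists_character_quotient_injective_intertwiningMap_cmPrincipalSeries`
import Literature.NumberTheory.Automorphic.UnitaryGroupRankOneTorusCharacters        -- ★ `exists_cmTorusCharPair_eq`
import Literature.NumberTheory.Automorphic.UnitaryGroupLocalFactors                  -- ★ `continuous_conjLocal`
import Literature.NumberTheory.Automorphic.U3JacquetVanishingSupercuspidal            -- ★ N6 `u3_isSupercuspidal_iff_jacquet_eq_zero_holds`
import Literature.NumberTheory.Rogawski1990.CMLocalAPacketMembers                     -- ★ `Gqs`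
import Summits.HodgeConjecture.HodgeConjecture.Theorems.F0P2pTorusPairsAndVacuity      -- ★ `continuous_of_smoothInd_ne_zero`, `continuous_components_of_continuous_torusCharPair`
import HarnessLib

/-!
# Crux `H413` — the Jacquet embedding dichotomy for `U(Φ₃)(L⁺_v)` in the `(χ₁, χ₂)` spelling

Cell hodgecm-mathlib (D-0151), FLOOR 0, crux item H413 = stmt-HodgeConjecture-24833 (`--supports`, helper; desk F0P3b-plan (g10) row
(A′) 2026-08-31).  HC_CM is proved only modulo the 2 remaining named inputs (hLiu418, h413) until rung 0 closes; nothing here proves HC_CM.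

THE MATHEMATICS [BernsteinZelevinsky1977, Prop. 1.9 (b), §2.3–2.5; Casselman1995, Thm. 3.2.4, 5.1.2; Rogawski1990, §12.1 pp. 171–172,
§12.2 p. 173].  Let `v` be a finite place of `L⁺` and `π` an irreducible smooth representation of `G = U(Φ₃)(L⁺_v)` (★ `Gqs L v`).
* **D1** `exists_injective_intertwiningMap_cmPrincipalSeries`: if the Jacquet module `r_B(π)` is non-zero then there are CONTINUOUS
  characters `χ₁` of `E* = (∏_{w∣v} L_w)ˣ` and `χ₂` of `E¹` and an injective `G`-map `π ↪ i_G(χ₁, χ₂) = cmPrincipalSeries L 3 v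
  (cmTorusCharPair L v χ₁ χ₂)`.  Proof: ★ brick A (`JacquetNonzeroEmbedsNormalizedInd`: `r_B(π) ≠ 0` ⇒ `π ↪ i_G(χ)` for a quotient
  character `χ` of `r_B(π)`); every character of the torus is a pair character (★ `exists_cmTorusCharPair_eq`); a non-zero vector of
  `i_G(χ)` — the image of a non-zero vector of the irreducible `π` — forces `χ` to be continuous (★ `continuous_of_smoothInd_ne_zero`), and
  the components of a continuous pair character are continuous (★ `continuous_components_of_continuous_torusCharPair`).
* **D2** `isSupercuspidal_or_exists_injective_intertwiningMap_cmPrincipalSeries`: at a NON-SPLIT `v`, every irreducible smooth `π` is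
  supercuspidal or embeds into a principal series `i_G(χ₁, χ₂)` with continuous `χ₁, χ₂` — by ★ N6 (Harish-Chandra's criterion,
  `u3_isSupercuspidal_iff_jacquet_eq_zero_holds`: `r_B(π) = 0` ⇒ supercuspidal) and D1.
This is the structural input of the K-spherical ∕ SqNS (#90) ∕ T7 roads («a non-supercuspidal irreducible is a constituent of a principal
series»), stated in the `(χ₁, χ₂)` vocabulary of the booked U(3) letters N1–N5.  Theorems only; no definition, no named fact, no instance.

ELABORATION NOTES (measured).  `Gqs L v` is an `abbrev` for `(cmDatum L 3 Φ₃).Local v`, definitionally the matrix group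
`↥(unitaryGroupOfForm (conjLocal …) (cmLocalForm L 3 v))` but not at instance transparency: `r.ρ` is therefore first read on the matrix
carrier (`let π … := r.ρ`) and its irreducibility ∕ smoothness passed explicitly.  `obtain ⟨…⟩ := term` generalises `term` over the
≈ 10⁷-node goal and times out; `have h := term; rcases h` does not.  D1 carries `maxHeartbeats 2000000` for the one carrier crossing
`f x : SmoothInd …` (read through `cmPrincipalSeries = normalizedInd = smoothIndRep`).

## References
* [BernsteinZelevinsky1977] I. N. Bernstein, A. V. Zelevinsky, *Induced representations of reductive p-adic groups. I*, Prop. 1.9 (b), §2.3–2.5.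
* [Casselman1995] W. Casselman, *Introduction to the theory of admissible representations of p-adic reductive groups*, Thm. 3.2.4, 5.1.2.
* [Rogawski1990] J. Rogawski, *Automorphic representations of unitary groups in three variables*, §12.1 pp. 171–172, §12.2 p. 173.
-/

set_option autoImplicit false
-- the mandated namespace has the single-problem summit's repeated segment (`HodgeConjecture.HodgeConjecture`)
set_option linter.dupNamespace false

noncomputable section

open NumberField IsDedekindDomain MeasureTheory
open scoped Matrix

namespace Summit.HodgeConjecture.HodgeConjecture.Cruxes.H413.F0P3JacquetEmbeddingDichotomy

open Literature.NumberTheory Literature.NumberTheory.Automorphic Literature.NumberTheory.Automorphic.UnitaryGroup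
open Literature.NumberTheory.Rogawski1990

variable (L : Type) [Field L] [NumberField L] [IsCMField L]

set_option maxHeartbeats 2000000 in  -- one carrier crossing: `f x : SmoothInd …` read through `cmPrincipalSeries = normalizedInd = smoothIndRep`
/-- **D1 — an irreducible smooth representation of `U(Φ₃)(L⁺_v)` with non-zero Jacquet module embeds into a principal series
`i_G(χ₁, χ₂)` with CONTINUOUS `χ₁, χ₂`** (every finite `v`, split or not): ★ brick A gives `π ↪ i_G(χ)` for a quotient character `χ` of
`r_B(π)`; `χ = (χ₁, χ₂)` by ★ `exists_cmTorusCharPair_eq`; `χ` is continuous because `i_G(χ)` has a non-zero vector (★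
`continuous_of_smoothInd_ne_zero`), and then so are `χ₁, χ₂` (★ `continuous_components_of_continuous_torusCharPair`).
[cite: BernsteinZelevinsky1977, Prop. 1.9 (b), §2.3] [cite: Casselman1995, Thm. 3.2.4] [cite: Rogawski1990, §12.1 pp. 171–172] -/
theorem exists_injective_intertwiningMap_cmPrincipalSeries (v : HeightOneSpectrum (𝓞 ↥(maximalRealSubfield L)))
    (r : SmoothIrrep (Gqs L v)) (h : ¬ Subsingleton ((cmBorelTriple L 3 v).restrict r.ρ).Coinvariants) :
    ∃ (χ₁ : (LocalRing L v)ˣ →* ℂˣ) (χ₂ : ↥(normOneUnits (conjLocal L (IsCMField.complexConj L) v)) →* ℂˣ),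
      Continuous (fun x => ((χ₁ x : ℂˣ) : ℂ)) ∧ Continuous (fun x => ((χ₂ x : ℂˣ) : ℂ)) ∧
      ∃ f : r.ρ.IntertwiningMap (cmPrincipalSeries L 3 v (cmTorusCharPair L v χ₁ χ₂)), Function.Injective f := by
  -- read `r.ρ` on the matrix carrier `U(Φ₃)(L⁺_v)` (the `abbrev Gqs` unfolds to it, but not at instance transparency)
  let π : Representation ℂ ↥(unitaryGroupOfForm (conjLocal L (IsCMField.complexConj L) v) (cmLocalForm L 3 v)) r.V := r.ρ
  have hirr : π.IsIrreducible := r.isIrreducible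
  have hsm : π.IsSmooth := r.isSmooth
  have hnt : Nontrivial ((cmBorelTriple L 3 v).restrict π).Coinvariants := not_subsingleton_iff_nontrivial.1 h
  haveI := locallyCompactSpace_cmBorelU L 3 v
  obtain ⟨χ, -, f, hf⟩ :=
    @exists_character_quotient_injective_intertwiningMap_cmPrincipalSeries L _ _ _ 3 v r.V _ _ π hirr hsm hnt
  -- (`have` + `rcases`, not `obtain … := term`: the latter generalises the term over the ≈ 10⁷-node goal and times out)
  have hpair := exists_cmTorusCharPair_eq L v χ
  rcases hpair with ⟨χ₁, χ₂, hχ⟩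
  subst hχ
  -- continuity: a non-zero vector of `i(χ)` (the image of a non-zero vector of the irreducible `r.ρ`) forces `χ` continuous
  haveI : Nontrivial r.V := Representation.IsIrreducible.nontrivial r.ρ
  have hex := exists_ne (0 : r.V)
  rcases hex with ⟨x, hx⟩
  have hfx : f x ≠ 0 := fun h0 => hx (hf (by rw [h0, map_zero]))
  have hcont := F0P2pTorusPairsAndVacuity.continuous_of_smoothInd_ne_zero (cmBorelTriple L 3 v)
    (cmTorusCharPair L v χ₁ χ₂) (f x) hfx
  have hcomp := F0P2pTorusPairsAndVacuity.continuous_components_of_continuous_torusCharPair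
    (conjLocal L (IsCMField.complexConj L) v) (continuous_conjLocal L (IsCMField.complexConj L) v)
    (conjLocal_conjLocal_cm L v) (cmLocalForm L 3 v) (cmLocalForm_eq_over L 3 v) χ₁ χ₂ hcont
  exact ⟨χ₁, χ₂, hcomp.1, hcomp.2, f, hf⟩

/-- **D2 — dichotomy at a non-split place: an irreducible smooth representation of `U(Φ₃)(L⁺_v)` is supercuspidal, or it embeds into a
principal series `i_G(χ₁, χ₂)` with continuous `χ₁, χ₂`** — ★ N6 (`r_B(π) = 0` ⇒ supercuspidal, Harish-Chandra ∕ Casselman 5.3.1 for `U(3)`,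
`u3_isSupercuspidal_iff_jacquet_eq_zero_holds`) or D1. [cite: Rogawski1990, §12.1 pp. 171–172; §12.2 p. 173] [cite: Casselman1995, Thm. 5.1.2, Thm. 5.3.1]
[cite: BernsteinZelevinsky1977, §2.5] -/
theorem isSupercuspidal_or_exists_injective_intertwiningMap_cmPrincipalSeries
    (v : HeightOneSpectrum (𝓞 ↥(maximalRealSubfield L)))
    (hns : ∀ w : PlacesOver L v, IsCMField.complexConj L • w.1 = w.1) (r : SmoothIrrep (Gqs L v)) :
    (IrrClass.mk r).IsSupercuspidal ∨
      ∃ (χ₁ : (LocalRing L v)ˣ →* ℂˣ) (χ₂ : ↥(normOneUnits (conjLocal L (IsCMField.complexConj L) v)) →* ℂˣ),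
        Continuous (fun x => ((χ₁ x : ℂˣ) : ℂ)) ∧ Continuous (fun x => ((χ₂ x : ℂˣ) : ℂ)) ∧
        ∃ f : r.ρ.IntertwiningMap (cmPrincipalSeries L 3 v (cmTorusCharPair L v χ₁ χ₂)), Function.Injective f := by
  by_cases hsub : Subsingleton ((cmBorelTriple L 3 v).restrict r.ρ).Coinvariants
  · exact Or.inl ((u3_isSupercuspidal_iff_jacquet_eq_zero_holds L v hns r).2 hsub)
  · exact Or.inr (exists_injective_intertwiningMap_cmPrincipalSeries L v r hsub)

/-! ## ED. 2 (append-only): the class-level form -/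

/-- **D2′ — class-level dichotomy at a non-split place**: every irreducible class `c` of `U(Φ₃)(L⁺_v)` is supercuspidal, or it is the class
of an `r` that embeds into a principal series `i_G(χ₁, χ₂)` with continuous `χ₁, χ₂` (D2 at a representative, ★ `IrrClass.mk_surjective`;
no `subst` of `c` — the goal carries the carrier). [cite: Rogawski1990, §12.1 pp. 171–172; §12.2 p. 173] [cite: Casselman1995, Thm. 5.1.2, Thm. 5.3.1]
[cite: BernsteinZelevinsky1977, §2.5] -/
theorem isSupercuspidal_or_exists_injective_intertwiningMap_cmPrincipalSeries_of_irrClass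
    (v : HeightOneSpectrum (𝓞 ↥(maximalRealSubfield L)))
    (hns : ∀ w : PlacesOver L v, IsCMField.complexConj L • w.1 = w.1) (c : IrrClass (Gqs L v)) :
    c.IsSupercuspidal ∨
      ∃ r : SmoothIrrep (Gqs L v), IrrClass.mk r = c ∧
        ∃ (χ₁ : (LocalRing L v)ˣ →* ℂˣ) (χ₂ : ↥(normOneUnits (conjLocal L (IsCMField.complexConj L) v)) →* ℂˣ),
          Continuous (fun x => ((χ₁ x : ℂˣ) : ℂ)) ∧ Continuous (fun x => ((χ₂ x : ℂˣ) : ℂ)) ∧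
          ∃ f : r.ρ.IntertwiningMap (cmPrincipalSeries L 3 v (cmTorusCharPair L v χ₁ χ₂)), Function.Injective f := by
  have hc' := IrrClass.mk_surjective c
  rcases hc' with ⟨r, hr⟩
  have hD2 := isSupercuspidal_or_exists_injective_intertwiningMap_cmPrincipalSeries L v hns r
  rcases hD2 with h | h
  · left
    rw [← hr]
    exact h
  · exact Or.inr ⟨r, hr, h⟩

end Summit.HodgeConjecture.HodgeConjecture.Cruxes.H413.F0P3JacquetEmbeddingDichotomy


end
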